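import Summits.KontsevichZagierPeriods.KontsevichZagierPeriods.Theorems.TerasomaMultiplicationBetaCancellationStubWallRestrict

/-!
# `BetaCancellation` (stmt-KontsevichZagierPeriods-13633), line `dirichlet-companion-to-pi` — stub `stub_regionRestrict`

**Region restriction.** Let `T ⊆ ℝ²` be a region such that every cylinder
`{z : ℝᵏ⁺² | (z 0, z 1) ∈ T}` over the two disc coordinates is `ℚ`-semialgebraic, and let
`H : FormalRep →+ FormalRep` be any additive endomorphism which kills the generators of dimension
`0` and `1` and sends the generator `[r]` of a representation `r` of dimension `k + 2` to `[s]`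
whenever `s` is the restriction of `r` to `r.domain ∩ {z | (z 0, z 1) ∈ T}` (same integrand).
Then `H` maps the subgroup generated by the *region-respecting generators* — all domain- and
integrand-additivity instances (`KZ.domainAddRel`, `KZ.integrandAddRel`), the changes of variables
`Φ` on `(n+2)`-dimensional representations preserving membership of `(x 0, x 1)` in `T` pointwise on
the domain, and the Newton–Leibniz moves `of r − of r'` with `r : IntegralRep (n + 3)`,
`r' : IntegralRep (n + 2)` (base of dimension `≥ 2`) — into `KZ.relations`.

Proof. The two-coordinate version of `stub_wallRestrict` / `wallRestrict_of_side`
(`TerasomaMultiplicationBetaCancellationStubWallRestrict.lean`), generator by generator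
(`AddSubgroup.closure_le` for `relations.comap H`): a restricted additivity instance is an
additivity instance (the general `wallRestrict_domainAddRel`, `wallRestrict_integrandAddRel` with
the cylinder `{z | (z 0, z 1) ∈ T}`; in dimensions `0` and `1` the image is `0`); a
region-respecting change of variables maps `r.domain ∩ {(z 0, z 1) ∈ T}` onto
`r'.domain ∩ {(z 0, z 1) ∈ T}` because `(Φ x 0, Φ x 1) ∈ T ↔ (x 0, x 1) ∈ T`, all other clauses
restrict (`regionRestrict_changeOfVariablesRel`); a Newton–Leibniz move over a base of dimension
`≥ 2` (unfolded from the verbatim dimension-pinned set by reading off coefficients in the free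
abelian group, `regionRestrict_mem_newtonLeibnizRel_iff`, `KZ.sigma_eq_of_of_sub_of_eq`) restricts
to the Newton–Leibniz move over the restricted base, since both disc coordinates are base
coordinates: `(Fin.init z) 0 = z 0`, `(Fin.init z) 1 = z 1` (`regionRestrict_newtonLeibnizRel`).
The cylinders are `ℚ`-semialgebraic by hypothesis, so the restricted representations exist
(`KZ.IntegralRep.restrict`, `regionRestrict_exists_restrict`) and `H` is evaluated on them through
its pinning hypotheses only. No definitions; sorry-free;
axioms ⊆ {propext, Classical.choice, Quot.sound}.

References: M. Kontsevich, D. Zagier, *Periods* (2001), §1.2 rules (1)–(3); J. Ayoub, *Une version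
relative de la conjecture des périodes de Kontsevich–Zagier*, Ann. of Math. 181 (2015), §1.
-/

noncomputable section

-- `Summit.KontsevichZagierPeriods.KontsevichZagierPeriods.…` is the tree's mandated layout (single-conjunct summit).
set_option linter.dupNamespace false

namespace Summit.KontsevichZagierPeriods.KontsevichZagierPeriods.BetaCancellationLine

open Set
open Literature.NumberTheory.Transcendental
open Literature.NumberTheory.Transcendental.KZ

/-! ### Restrictions to a semialgebraic cylinder exist -/

/-- **Region restrictions of a family exist**: for a `ℚ`-semialgebraic cylinder
`{z | (z 0, z 1) ∈ T}` every representation `r` of dimension `≥ 2` has a restriction to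
`r.domain ∩ {z | (z 0, z 1) ∈ T}` with the same integrand (`KZ.IntegralRep.restrict`). [folklore] -/
theorem regionRestrict_exists_restrict {k : ℕ} {T : Set (ℝ × ℝ)}
    (hT : Literature.ModelTheory.ExponentialFields.IsSemialgebraic ℚ
      {z : Fin (k + 2) → ℝ | (z 0, z 1) ∈ T})
    (r : IntegralRep (k + 2)) :
    ∃ s : IntegralRep (k + 2),
      s.domain = r.domain ∩ {z | (z 0, z 1) ∈ T} ∧ s.integrand = r.integrand :=
  ⟨r.restrict (r.domain ∩ {z | (z 0, z 1) ∈ T}) (r.isSemialgebraic_domain.inter hT)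
      inter_subset_left,
    rfl, rfl⟩

/-! ### Restriction to a cylinder preserves the region-respecting generators -/

/-- **Restriction of a region-respecting change of variables to the cylinder over the region is a
change of variables**: since `(Φ x 0, Φ x 1) ∈ T ↔ (x 0, x 1) ∈ T` on `r.domain`, `Φ` maps
`r.domain ∩ {(z 0, z 1) ∈ T}` onto `r'.domain ∩ {(z 0, z 1) ∈ T}`; semialgebraicity,
differentiability within the domain, injectivity and the Jacobian identity restrict.
[cite: KontsevichZagier2001, §1.2 rule (2)] -/
theorem regionRestrict_changeOfVariablesRel {k : ℕ} (T : Set (ℝ × ℝ))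
    {r r' s s' : IntegralRep (k + 2)}
    {Φ : (Fin (k + 2) → ℝ) → (Fin (k + 2) → ℝ)}
    {Φ' : (Fin (k + 2) → ℝ) → (Fin (k + 2) → ℝ) →L[ℝ] (Fin (k + 2) → ℝ)}
    (hΦ : IsSemialgebraicMapOn ℚ r.domain Φ)
    (hΦ' : ∀ x ∈ r.domain, HasFDerivWithinAt Φ (Φ' x) r.domain x) (hinj : InjOn Φ r.domain)
    (hdom : r'.domain = Φ '' r.domain)
    (hf : ∀ x ∈ r.domain, r.integrand x = r'.integrand (Φ x) * |(Φ' x).det|)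
    (hreg : ∀ x ∈ r.domain, (Φ x 0, Φ x 1) ∈ T ↔ (x 0, x 1) ∈ T)
    (hs : s.domain = r.domain ∩ {z | (z 0, z 1) ∈ T}) (hsi : s.integrand = r.integrand)
    (hs' : s'.domain = r'.domain ∩ {z | (z 0, z 1) ∈ T}) (hs'i : s'.integrand = r'.integrand) :
    of s - of s' ∈ changeOfVariablesRel := by
  have hsub : s.domain ⊆ r.domain := hs.trans_subset inter_subset_left
  refine ⟨k + 2, s, s', Φ, Φ', hΦ.mono hsub s.isSemialgebraic_domain,
    fun x hx => (hΦ' x (hsub hx)).mono hsub, hinj.mono hsub, ?_, fun x hx => ?_, rfl⟩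
  · rw [hs', hs, hdom]
    ext y
    simp only [mem_inter_iff, mem_image, mem_setOf_eq]
    constructor
    · rintro ⟨⟨x, hx, rfl⟩, hy⟩
      exact ⟨x, ⟨hx, (hreg x hx).mp hy⟩, rfl⟩
    · rintro ⟨x, ⟨hx, hxT⟩, rfl⟩
      exact ⟨⟨x, hx, rfl⟩, (hreg x hx).mpr hxT⟩
  · rw [hsi, hs'i]
    exact hf x (hsub hx)

/-- **The region-respecting Newton–Leibniz set, unfolded**: `c ∈ newtonLeibnizRel` of the
dimension shape `(n+3, n+2)` iff `c = of r − of r'` for Newton–Leibniz data (band `r`, base `r'`,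
bounds `a ≤ b`, primitive `F`, exactly the clauses of `KZ.newtonLeibnizRel`) over a base
`r' : IntegralRep (n + 2)` of dimension `≥ 2` (the coefficients of the free abelian group identify
the data, `KZ.sigma_eq_of_of_sub_of_eq`; cf. `KZ.mem_fibredNewtonLeibnizRel_iff`).
[cite: KontsevichZagier2001, §1.2 rule (3)] -/
theorem regionRestrict_mem_newtonLeibnizRel_iff {c : FormalRep} :
    (c ∈ newtonLeibnizRel ∧
        ∃ (n : ℕ) (r : IntegralRep (n + 3)) (r' : IntegralRep (n + 2)), c = of r - of r') ↔
      ∃ (n : ℕ) (r : IntegralRep (n + 3)) (r' : IntegralRep (n + 2)) (a b : (Fin (n + 2) → ℝ) → ℝ)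
        (F : (Fin (n + 3) → ℝ) → ℝ),
        IsSemialgebraicFunOn ℚ r.domain F ∧
        IsSemialgebraicFunOn ℚ r'.domain a ∧ IsSemialgebraicFunOn ℚ r'.domain b ∧
        (∀ x ∈ r'.domain, a x ≤ b x) ∧
        r.domain = {z | (Fin.init z : Fin (n + 2) → ℝ) ∈ r'.domain ∧
          a (Fin.init z) ≤ z (Fin.last (n + 2)) ∧ z (Fin.last (n + 2)) ≤ b (Fin.init z)} ∧
        (∀ x ∈ r'.domain, ContinuousOn (fun t : ℝ => F (Fin.snoc x t)) (Icc (a x) (b x))) ∧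
        (∀ x ∈ r'.domain, ∀ t ∈ Ioo (a x) (b x),
          HasDerivAt (fun s : ℝ => F (Fin.snoc x s)) (r.integrand (Fin.snoc x t)) t) ∧
        (∀ x ∈ r'.domain, r'.integrand x = F (Fin.snoc x (b x)) - F (Fin.snoc x (a x))) ∧
        c = of r - of r' := by
  constructor
  · rintro ⟨⟨m, ρ, ρ', a, b, F, hF, ha, hb, hle, hband, hcont, hderiv, hρ', rfl⟩, k, r, r', h⟩
    have hne : (⟨m + 1, ρ⟩ : Σ k, IntegralRep k) ≠ ⟨m, ρ'⟩ := fun h' => by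
      have := congrArg Sigma.fst h'
      simp at this
    have hm : m = k + 2 := by
      have := congrArg Sigma.fst (sigma_eq_of_of_sub_of_eq hne h).1
      simp only at this
      omega
    subst hm
    exact ⟨k, ρ, ρ', a, b, F, hF, ha, hb, hle, hband, hcont, hderiv, hρ', rfl⟩
  · rintro ⟨k, r, r', a, b, F, hF, ha, hb, hle, hband, hcont, hderiv, hr', rfl⟩
    exact ⟨⟨k + 2, r, r', a, b, F, hF, ha, hb, hle, hband, hcont, hderiv, hr', rfl⟩, k, r, r', rfl⟩

/-- **Restriction of a Newton–Leibniz move over a base of dimension `≥ 2` to the cylinder over the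
region is again such a move**: both disc coordinates are base coordinates (`(Fin.init z) 0 = z 0`,
`(Fin.init z) 1 = z 1`), so the restricted band is the band over the restricted base, with the same
bounds and primitive. [cite: KontsevichZagier2001, §1.2 rule (3)] -/
theorem regionRestrict_newtonLeibnizRel {n : ℕ} (T : Set (ℝ × ℝ)) {r s : IntegralRep (n + 3)}
    {r' s' : IntegralRep (n + 2)} {α β : (Fin (n + 2) → ℝ) → ℝ} {F : (Fin (n + 3) → ℝ) → ℝ}
    (hF : IsSemialgebraicFunOn ℚ r.domain F)
    (hα : IsSemialgebraicFunOn ℚ r'.domain α) (hβ : IsSemialgebraicFunOn ℚ r'.domain β)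
    (hle : ∀ x ∈ r'.domain, α x ≤ β x)
    (hband : r.domain = {z | (Fin.init z : Fin (n + 2) → ℝ) ∈ r'.domain ∧
      α (Fin.init z) ≤ z (Fin.last (n + 2)) ∧ z (Fin.last (n + 2)) ≤ β (Fin.init z)})
    (hcont : ∀ x ∈ r'.domain, ContinuousOn (fun t : ℝ => F (Fin.snoc x t)) (Icc (α x) (β x)))
    (hderiv : ∀ x ∈ r'.domain, ∀ t ∈ Ioo (α x) (β x),
      HasDerivAt (fun s : ℝ => F (Fin.snoc x s)) (r.integrand (Fin.snoc x t)) t)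
    (hr' : ∀ x ∈ r'.domain, r'.integrand x = F (Fin.snoc x (β x)) - F (Fin.snoc x (α x)))
    (hs : s.domain = r.domain ∩ {z | (z 0, z 1) ∈ T}) (hsi : s.integrand = r.integrand)
    (hs' : s'.domain = r'.domain ∩ {z | (z 0, z 1) ∈ T}) (hs'i : s'.integrand = r'.integrand) :
    of s - of s' ∈ newtonLeibnizRel := by
  have hsub : s.domain ⊆ r.domain := hs.trans_subset inter_subset_left
  have hsub' : s'.domain ⊆ r'.domain := hs'.trans_subset inter_subset_left
  refine ⟨n + 2, s, s', α, β, F, hF.mono hsub s.isSemialgebraic_domain,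
    hα.mono hsub' s'.isSemialgebraic_domain, hβ.mono hsub' s'.isSemialgebraic_domain,
    fun x hx => hle x (hsub' hx), ?_, fun x hx => hcont x (hsub' hx), fun x hx t ht => ?_,
    fun x hx => ?_, rfl⟩
  · rw [hs, hs', hband]
    ext z
    simp only [mem_inter_iff, mem_setOf_eq]
    have h0 : Fin.init z 0 = z 0 := rfl
    have h1 : Fin.init z 1 = z 1 := rfl
    rw [h0, h1]
    tauto
  · rw [hsi]
    exact hderiv x (hsub' hx) t ht
  · rw [hs'i]
    exact hr' x (hsub' hx)

/-! ### Region restriction maps region-respecting relations to relations -/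

/-- STUB (region restriction): restriction to a cylinder `{(z 0, z 1) ∈ T}` over the two disc
coordinates maps region-respecting relations to relations. [folklore] -/
theorem stub_regionRestrict :
    ∀ (T : Set (ℝ × ℝ)), (∀ k : ℕ, Literature.ModelTheory.ExponentialFields.IsSemialgebraic ℚ {z : Fin (k + 2) → ℝ | (z 0, z 1) ∈ T}) → ∀ (H : FormalRep →+ FormalRep), (∀ r : IntegralRep 0, H (of r) = 0) → (∀ r : IntegralRep 1, H (of r) = 0) → (∀ (k : ℕ) (r s : IntegralRep (k + 2)), s.domain = r.domain ∩ {z | (z 0, z 1) ∈ T} → s.integrand = r.integrand → H (of r) = of s) → ∀ x ∈ AddSubgroup.closure (domainAddRel ∪ integrandAddRel ∪ {x | ∃ (n : ℕ) (r r' : IntegralRep (n + 2)) (Φ : (Fin (n + 2) → ℝ) → (Fin (n + 2) → ℝ)) (Φ' : (Fin (n + 2) → ℝ) → (Fin (n + 2) → ℝ) →L[ℝ] (Fin (n + 2) → ℝ)), IsSemialgebraicMapOn ℚ r.domain Φ ∧ (∀ x ∈ r.domain, HasFDerivWithinAt Φ (Φ' x) r.domain x) ∧ Set.InjOn Φ r.domain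 ∧ r'.domain = Φ '' r.domain ∧ (∀ x ∈ r.domain, r.integrand x = r'.integrand (Φ x) * |(Φ' x).det|) ∧ (∀ x ∈ r.domain, (Φ x 0, Φ x 1) ∈ T ↔ (x 0, x 1) ∈ T) ∧ x = of r - of r'} ∪ {x | x ∈ newtonLeibnizRel ∧ ∃ (n : ℕ) (r : IntegralRep (n + 3)) (r' : IntegralRep (n + 2)), x = of r - of r'}), H x ∈ relations := by
  intro T hT H h0 h1 hpin x hx
  refine (AddSubgroup.closure_le (relations.comap H)).mpr ?_ hx
  rintro y (((hy | hy) | hy) | hy)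
  · obtain ⟨k, r, r₁, r₂, hdom, hnull, h₁, h₂, rfl⟩ := hy
    rw [AddSubgroup.coe_comap, mem_preimage, map_sub, map_sub]
    rcases k with _ | _ | k
    · rw [h0 r, h0 r₁, h0 r₂, sub_zero, sub_zero]
      exact relations.zero_mem
    · rw [h1 r, h1 r₁, h1 r₂, sub_zero, sub_zero]
      exact relations.zero_mem
    · obtain ⟨s, hs, hsi⟩ := regionRestrict_exists_restrict (hT k) r
      obtain ⟨s₁, hs₁, hs₁i⟩ := regionRestrict_exists_restrict (hT k) r₁
      obtain ⟨s₂, hs₂, hs₂i⟩ := regionRestrict_exists_restrict (hT k) r₂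
      rw [hpin k r s hs hsi, hpin k r₁ s₁ hs₁ hs₁i, hpin k r₂ s₂ hs₂ hs₂i]
      exact domainAddRel_subset_relations
        (wallRestrict_domainAddRel hdom hnull h₁ h₂ hs hsi hs₁ hs₁i hs₂ hs₂i)
  · obtain ⟨k, r, r₁, r₂, h₁, h₂, hadd, rfl⟩ := hy
    rw [AddSubgroup.coe_comap, mem_preimage, map_sub, map_sub]
    rcases k with _ | _ | k
    · rw [h0 r, h0 r₁, h0 r₂, sub_zero, sub_zero]
      exact relations.zero_mem
    · rw [h1 r, h1 r₁, h1 r₂, sub_zero, sub_zero]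
      exact relations.zero_mem
    · obtain ⟨s, hs, hsi⟩ := regionRestrict_exists_restrict (hT k) r
      obtain ⟨s₁, hs₁, hs₁i⟩ := regionRestrict_exists_restrict (hT k) r₁
      obtain ⟨s₂, hs₂, hs₂i⟩ := regionRestrict_exists_restrict (hT k) r₂
      rw [hpin k r s hs hsi, hpin k r₁ s₁ hs₁ hs₁i, hpin k r₂ s₂ hs₂ hs₂i]
      exact integrandAddRel_subset_relations
        (wallRestrict_integrandAddRel h₁ h₂ hadd hs hsi hs₁ hs₁i hs₂ hs₂i)
  · obtain ⟨k, r, r', Φ, Φ', hΦ, hΦ', hinj, hdom, hf, hreg, rfl⟩ := hy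
    rw [AddSubgroup.coe_comap, mem_preimage, map_sub]
    obtain ⟨s, hs, hsi⟩ := regionRestrict_exists_restrict (hT k) r
    obtain ⟨s', hs', hs'i⟩ := regionRestrict_exists_restrict (hT k) r'
    rw [hpin k r s hs hsi, hpin k r' s' hs' hs'i]
    exact changeOfVariablesRel_subset_relations
      (regionRestrict_changeOfVariablesRel T hΦ hΦ' hinj hdom hf hreg hs hsi hs' hs'i)
  · obtain ⟨k, r, r', α, β, F, hF, hα, hβ, hle, hband, hcont, hderiv, hr', rfl⟩ :=
      regionRestrict_mem_newtonLeibnizRel_iff.mp hy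
    rw [AddSubgroup.coe_comap, mem_preimage, map_sub]
    obtain ⟨s, hs, hsi⟩ := regionRestrict_exists_restrict (hT (k + 1)) r
    obtain ⟨s', hs', hs'i⟩ := regionRestrict_exists_restrict (hT k) r'
    rw [hpin (k + 1) r s hs hsi, hpin k r' s' hs' hs'i]
    exact newtonLeibnizRel_subset_relations
      (regionRestrict_newtonLeibnizRel T hF hα hβ hle hband hcont hderiv hr' hs hsi hs' hs'i)

end Summit.KontsevichZagierPeriods.KontsevichZagierPeriods.BetaCancellationLine
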